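import Mathlib.Analysis.SpecialFunctions.Pow.Real
import HarnessLib

/-!
# QUANT lane R8, DIB\* with ONE light blob at every floor `≥ 1/2`: the algebra of the Cantelli cell

builds on p205010 (kernel theorem, internal audit signed; external expert review pending)

Support file (`--supports stmt-CriticalPhenomena-4575`), QUANT lane seat prim-quant-p1 (gen 11); memo
`run/shared/lean/prim/quant/P1-SURPLUS.md` §22.  Pure real-polynomial inequalities (no probability), consumed by
`…QuantIndepBlobOneLightAllFloors.lean`.  Theorems only; no sorries; standard axioms.

SETTING (normalised picture).  One light blob `(b, g)` with `x² ≤ g ≤ x`, `0 ≤ b ≤ j`, among heavy blobs of total size `A ≤ 2j` and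
mean `B`, floor `1/2 ≤ x < 1`, NOT mergeable (`g·A < j`), DIB\* credit `2j < B + b(g − x²)/(1 − x)`.  Cantelli certifies the row
`P(N ≥ j+1) ≥ x` as soon as `x·V ≤ (1−x)(m − j)²` with the mean `m = B + bg` and the variance bounded by `V ≤ j(A − B) + b²g(1−g)`
(heavy sizes `≤ j`).  `OneLightAlg.main` proves exactly this inequality from the constraints.  Reduction (memo §22.3): the target is
monotone in `B` (replace it by the credit bound) and in `A` (replace it by `j/g` when `g ≥ 1/2`, by `2j` when `g ≤ 1/2`); what is left is
a polynomial `P(x, g, b, j) = j²P₀ + jbP₁ + b²P₂` with `P₂ ≤ 0` (`L1`), so by concavity in `b` only `b = 0` (`P₀ ≥ 0`) and `b = j` (`L3`,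
a cubic in `g`, concave on `[max(x², 1/2), x]`, handled by the chord identity and its two endpoint values `T_at_half`, `T_at_sq`)
matter.  Numerically the cell has relative slack `≥ 0.2` on the whole region and `→ x(1−x)` as `x → 1` (memo §22.3).  [this work]
-/

namespace Summit.CriticalPhenomena.PercolationContinuityZ3.Theorems

namespace Quant

namespace IndepBlob

namespace OneLightAlg


/-- `L1`: the `b²`-coefficient `x(x−g)² − (1−x)g(1−g)` of `P` is nonpositive on `1/2 ≤ x ≤ 1`, `max(x², 1/2) ≤ g ≤ x`. [this work] -/
theorem L1 (x g : ℝ) (hx : 1 / 2 ≤ x) (hx1 : x ≤ 1) (hgx2 : x ^ 2 ≤ g) (hg2 : 1 / 2 ≤ g) (hgx : g ≤ x) :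
    x * (x - g) ^ 2 ≤ (1 - x) * g * (1 - g) := by
  have hy : 0 ≤ 1 - x := by linarith
  have hu : x - g ≤ x * (1 - x) := by nlinarith
  have hu0 : 0 ≤ x - g := by linarith
  have hgg : x * (1 - x) ≤ g * (1 - g) := by nlinarith
  calc x * (x - g) ^ 2 ≤ x * (x * (1 - x)) ^ 2 := by
        have : (x - g) ^ 2 ≤ (x * (1 - x)) ^ 2 := by
          apply pow_le_pow_left₀ hu0 hu
        exact mul_le_mul_of_nonneg_left this (by linarith)
    _ = (x * (1 - x)) * (x ^ 2 * (1 - x)) := by ring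
    _ ≤ (g * (1 - g)) * (1 * (1 - x)) := by
        apply mul_le_mul hgg _ (by positivity) (by nlinarith)
        nlinarith
    _ = (1 - x) * g * (1 - g) := by ring

/-- The cubic `T(g)` (the value of `P` at `b = j`, per `j²`) in closed form. [this work] -/
theorem T_eq (x g : ℝ) :
    (1 - x) * (g * (1 + x) - x) + x * g * (2 * (1 - x) * (x - g) - (g - x ^ 2))
      + x * g * (x * (x - g) ^ 2 - (1 - x) * g * (1 - g))
      = x * g ^ 3 - x * (2 * x ^ 2 - 3 * x + 4) * g ^ 2 + (x ^ 4 - x ^ 3 + x ^ 2 + 1) * g - x * (1 - x) := by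
  ring

/-- `T(x) = x²(1−x)³`. [this work] -/
theorem T_at_x (x : ℝ) :
    x * x ^ 3 - x * (2 * x ^ 2 - 3 * x + 4) * x ^ 2 + (x ^ 4 - x ^ 3 + x ^ 2 + 1) * x - x * (1 - x) = x ^ 2 * (1 - x) ^ 3 := by
  ring

/-- `T(1/2) > 0` for every real `x` (it is `t⁴/2 + 3t²/2 − t/8 + 1/32`, `t = x − 1/2`). [this work] -/
theorem T_at_half (x : ℝ) :
    0 < x * (1 / 2) ^ 3 - x * (2 * x ^ 2 - 3 * x + 4) * (1 / 2) ^ 2 + (x ^ 4 - x ^ 3 + x ^ 2 + 1) * (1 / 2) - x * (1 - x) := by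
  nlinarith [sq_nonneg (x - 1 / 2), sq_nonneg ((x - 1 / 2) ^ 2), sq_nonneg (x - 1 / 2 - 1 / 24)]

/-- `T(x²) = x(1−x)·(x³(1−x)(2−x) + x² + x − 1) ≥ 0` when `x² ≥ 1/2`, `1/2 ≤ x ≤ 1`. [this work] -/
theorem T_at_sq (x : ℝ) (hx : 1 / 2 ≤ x) (hx1 : x ≤ 1) (hx2 : 1 / 2 ≤ x ^ 2) :
    0 ≤ x * (x ^ 2) ^ 3 - x * (2 * x ^ 2 - 3 * x + 4) * (x ^ 2) ^ 2 + (x ^ 4 - x ^ 3 + x ^ 2 + 1) * x ^ 2 - x * (1 - x) := by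
  -- = x (1−x) U(x),  U = x³(x−1)(x−2) + (x² + x − 1)
  have e : x * (x ^ 2) ^ 3 - x * (2 * x ^ 2 - 3 * x + 4) * (x ^ 2) ^ 2 + (x ^ 4 - x ^ 3 + x ^ 2 + 1) * x ^ 2 - x * (1 - x)
      = x * (1 - x) * (x ^ 3 * ((1 - x) * (2 - x)) + (x ^ 2 + x - 1)) := by ring
  rw [e]
  have h1 : 0 ≤ x ^ 3 * ((1 - x) * (2 - x)) := by
    have : 0 ≤ x ^ 3 := by positivity
    exact mul_nonneg this (mul_nonneg (by linarith) (by linarith))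
  have h2 : 0 ≤ x ^ 2 + x - 1 := by nlinarith
  have h3 : 0 ≤ x * (1 - x) := mul_nonneg (by linarith) (by linarith)
  exact mul_nonneg h3 (by linarith)

/-- `L3`: `T(g) ≥ 0` on `[max(x², 1/2), x]` — the cubic is concave there (second divided difference `x(g + g₀ + x) − x(2x² − 3x + 4) < 0`), so the chord identity from the base point `g₀ ∈ {1/2, x²}` to `x` and the endpoint values `T_at_half` / `T_at_sq` / `T_at_x` suffice. [this work] -/
theorem L3 (x g : ℝ) (hx : 1 / 2 ≤ x) (hx1 : x < 1) (hgx2 : x ^ 2 ≤ g) (hg2 : 1 / 2 ≤ g) (hgx : g ≤ x) :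
    0 ≤ (1 - x) * (g * (1 + x) - x) + x * g * (2 * (1 - x) * (x - g) - (g - x ^ 2))
      + x * g * (x * (x - g) ^ 2 - (1 - x) * g * (1 - g)) := by
  rw [T_eq]
  set T : ℝ → ℝ := fun g => x * g ^ 3 - x * (2 * x ^ 2 - 3 * x + 4) * g ^ 2 + (x ^ 4 - x ^ 3 + x ^ 2 + 1) * g - x * (1 - x)
    with hT
  show 0 ≤ T g
  have hTx : T x = x ^ 2 * (1 - x) ^ 3 := T_at_x x
  have hTx0 : 0 ≤ T x := by rw [hTx]; exact mul_nonneg (sq_nonneg _) (pow_nonneg (by linarith) 3)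
  -- chord identity for the cubic, for any base point g₀
  have chord : ∀ g₀ : ℝ, (x - g₀) * T g = (x - g) * T g₀ + (g - g₀) * T x +
      (x - g₀) * (g - g₀) * (g - x) * (x * (g + g₀ + x) - x * (2 * x ^ 2 - 3 * x + 4)) := by
    intro g₀; simp only [hT]; ring
  -- the second divided difference is negative: g + g₀ + x − 2x² + 3x − 4 ≤ 6x − 2x² − 4 < 0
  have hdd : ∀ g₀ : ℝ, g₀ ≤ x → x * (g + g₀ + x) - x * (2 * x ^ 2 - 3 * x + 4) ≤ 0 := by
    intro g₀ hg₀
    have : g + g₀ + x - (2 * x ^ 2 - 3 * x + 4) ≤ 0 := by nlinarith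
    have hx0 : 0 ≤ x := by linarith
    nlinarith
  by_cases hx2 : x ^ 2 ≤ 1 / 2
  · -- base point g₀ = 1/2
    have hT0 : 0 ≤ T (1 / 2) := (T_at_half x).le
    have hid := chord (1 / 2)
    have h3 : 0 ≤ (x - 1 / 2) * (g - 1 / 2) * (g - x) * (x * (g + 1 / 2 + x) - x * (2 * x ^ 2 - 3 * x + 4)) := by
      have ha : 0 ≤ (x - 1 / 2) * (g - 1 / 2) := mul_nonneg (by linarith) (by linarith)
      have hb : 0 ≤ (g - x) * (x * (g + 1 / 2 + x) - x * (2 * x ^ 2 - 3 * x + 4)) :=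
        mul_nonneg_of_nonpos_of_nonpos (by linarith) (hdd (1 / 2) hx)
      calc (0 : ℝ) ≤ ((x - 1 / 2) * (g - 1 / 2)) * ((g - x) * (x * (g + 1 / 2 + x) - x * (2 * x ^ 2 - 3 * x + 4))) :=
            mul_nonneg ha hb
        _ = _ := by ring
    have hprod : 0 ≤ (x - 1 / 2) * T g := by
      rw [hid]
      have h1 : 0 ≤ (x - g) * T (1 / 2) := mul_nonneg (by linarith) hT0
      have h2 : 0 ≤ (g - 1 / 2) * T x := mul_nonneg (by linarith) hTx0
      linarith
    rcases eq_or_lt_of_le hx with hxe | hxl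
    · -- x = 1/2: then g = x
      have hg : g = x := le_antisymm hgx (by rw [← hxe]; exact hg2)
      rw [hg]; exact hTx0
    · exact nonneg_of_mul_nonneg_right hprod (by linarith : (0:ℝ) < x - 1 / 2)
  · -- base point g₀ = x²
    push Not at hx2
    have hT0 : 0 ≤ T (x ^ 2) := T_at_sq x hx hx1.le hx2.le
    have hid := chord (x ^ 2)
    have hxx : 0 < x - x ^ 2 := by nlinarith
    have h3 : 0 ≤ (x - x ^ 2) * (g - x ^ 2) * (g - x) * (x * (g + x ^ 2 + x) - x * (2 * x ^ 2 - 3 * x + 4)) := by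
      have ha : 0 ≤ (x - x ^ 2) * (g - x ^ 2) := mul_nonneg hxx.le (by linarith)
      have hb : 0 ≤ (g - x) * (x * (g + x ^ 2 + x) - x * (2 * x ^ 2 - 3 * x + 4)) :=
        mul_nonneg_of_nonpos_of_nonpos (by linarith) (hdd (x ^ 2) (by nlinarith))
      calc (0 : ℝ) ≤ ((x - x ^ 2) * (g - x ^ 2)) * ((g - x) * (x * (g + x ^ 2 + x) - x * (2 * x ^ 2 - 3 * x + 4))) :=
            mul_nonneg ha hb
        _ = _ := by ring
    have hprod : 0 ≤ (x - x ^ 2) * T g := by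
      rw [hid]
      have h1 : 0 ≤ (x - g) * T (x ^ 2) := mul_nonneg (by linarith) hT0
      have h2 : 0 ≤ (g - x ^ 2) * T x := mul_nonneg (by linarith) hTx0
      linarith
    exact nonneg_of_mul_nonneg_right (by linarith [hprod]) hxx

/-- `P ≥ 0` (the case `g ≥ 1/2`): `P = j²P₀ + jbP₁ + b²P₂` with `P₂ ≤ 0` (`L1`), `P₀ ≥ 0`, `P₀ + P₁ + P₂ ≥ 0` (`L3`); concavity in `b ∈ [0, j]`. [this work] -/
theorem Pnonneg (x g b j : ℝ) (hx : 1 / 2 ≤ x) (hx1 : x < 1) (hgx2 : x ^ 2 ≤ g) (hg2 : 1 / 2 ≤ g) (hgx : g ≤ x)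
    (hb : 0 ≤ b) (hbj : b ≤ j) :
    0 ≤ g * (j * (1 - x) + b * x * (x - g)) ^ 2 - x * (1 - x) * j ^ 2 * (1 - 2 * g) - x * j * b * g * (g - x ^ 2)
      - x * (1 - x) * b ^ 2 * g ^ 2 * (1 - g) := by
  have hP2 : x * g * (x * (x - g) ^ 2 - (1 - x) * g * (1 - g)) ≤ 0 := by
    have := L1 x g hx hx1.le hgx2 hg2 hgx
    have hxg : 0 ≤ x * g := by nlinarith
    nlinarith
  have hP0 : 0 ≤ (1 - x) * (g * (1 + x) - x) := by nlinarith
  have hP3 := L3 x g hx hx1 hgx2 hg2 hgx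
  have hj : 0 ≤ j := hb.trans hbj
  have key : g * (j * (1 - x) + b * x * (x - g)) ^ 2 - x * (1 - x) * j ^ 2 * (1 - 2 * g) - x * j * b * g * (g - x ^ 2)
      - x * (1 - x) * b ^ 2 * g ^ 2 * (1 - g)
      = j ^ 2 * ((1 - x) * (g * (1 + x) - x)) + j * b * (x * g * (2 * (1 - x) * (x - g) - (g - x ^ 2)))
        + b ^ 2 * (x * g * (x * (x - g) ^ 2 - (1 - x) * g * (1 - g))) := by ring
  rw [key]
  nlinarith [mul_nonneg (mul_nonneg hb (sub_nonneg.2 hbj)) (neg_nonneg.2 hP2), mul_nonneg (mul_nonneg (sub_nonneg.2 hbj) hj) hP0,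
    mul_nonneg (mul_nonneg hb hj) hP3]

/-- `φ(x) ≥ 0`: the value at `b = j` of the lower bound used in the case `g ≤ 1/2` (per `j²`), for `1/2 ≤ x`, `x² ≤ 1/2`. [this work] -/
theorem phi_nonneg (x : ℝ) (hx : 1 / 2 ≤ x) (hx2 : x ^ 2 ≤ 1 / 2) :
    0 ≤ ((1 - x) + x * (x - 1 / 2)) ^ 2 - x * (1 / 2 - x ^ 2) - x * (1 - x) * (1 / 4) := by
  have hx34 : x ≤ 3 / 4 := by nlinarith
  nlinarith [sq_nonneg (x - 1 / 2), mul_nonneg (sub_nonneg.2 hx) (sub_nonneg.2 hx34)]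

/-- `P'' ≥ 0` (the case `g ≤ 1/2`, where `x² ≤ 1/2`): replace `g` by its bounds (`x − g ≥ x − 1/2`, `g − x² ≤ 1/2 − x²`, `g(1−g) ≤ 1/4`) and use concavity in `b` again (`phi_nonneg` at `b = j`). [this work] -/
theorem P2nonneg (x g b j : ℝ) (hx : 1 / 2 ≤ x) (hx1 : x < 1) (hgx2 : x ^ 2 ≤ g) (hg2 : g ≤ 1 / 2)
    (hb : 0 ≤ b) (hbj : b ≤ j) :
    0 ≤ (j * (1 - x) + b * x * (x - g)) ^ 2 - x * j * b * (g - x ^ 2) - x * (1 - x) * b ^ 2 * g * (1 - g) := by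
  have hj : 0 ≤ j := hb.trans hbj
  have hx2 : x ^ 2 ≤ 1 / 2 := hgx2.trans hg2
  have hx34 : x ≤ 3 / 4 := by nlinarith
  -- replace `g` by its bounds: x − g ≥ x − 1/2 ≥ 0, g − x² ≤ 1/2 − x², g(1−g) ≤ 1/4
  have h1 : (j * (1 - x) + b * x * (x - 1 / 2)) ^ 2 ≤ (j * (1 - x) + b * x * (x - g)) ^ 2 := by
    apply pow_le_pow_left₀
    · have : 0 ≤ b * x * (x - 1 / 2) := by
        have : 0 ≤ x - 1 / 2 := by linarith
        positivity
      nlinarith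
    · have : b * x * (x - 1 / 2) ≤ b * x * (x - g) := by
        apply mul_le_mul_of_nonneg_left (by linarith) (by positivity)
      linarith
  have h2 : x * j * b * (g - x ^ 2) ≤ x * j * b * (1 / 2 - x ^ 2) := by
    apply mul_le_mul_of_nonneg_left (by linarith)
    have : 0 ≤ x := by linarith
    positivity
  have h3 : x * (1 - x) * b ^ 2 * g * (1 - g) ≤ x * (1 - x) * b ^ 2 * (1 / 4) := by
    have hgg : g * (1 - g) ≤ 1 / 4 := by nlinarith [sq_nonneg (g - 1 / 2)]
    have hc : 0 ≤ x * (1 - x) * b ^ 2 := by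
      have : 0 ≤ 1 - x := by linarith
      have : 0 ≤ x := by linarith
      positivity
    calc x * (1 - x) * b ^ 2 * g * (1 - g) = (x * (1 - x) * b ^ 2) * (g * (1 - g)) := by ring
      _ ≤ (x * (1 - x) * b ^ 2) * (1 / 4) := mul_le_mul_of_nonneg_left hgg hc
      _ = x * (1 - x) * b ^ 2 * (1 / 4) := by ring
  -- the lower bound Φ(b) = j² y² + j b c₁ + b² c₂ with c₂ ≤ 0, Φ(0) ≥ 0, Φ(j) = j² φ(x) ≥ 0
  have hc2 : x ^ 2 * (x - 1 / 2) ^ 2 - x * (1 - x) * (1 / 4) ≤ 0 := by nlinarith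
  have hφ := phi_nonneg x hx hx2
  have key : (j * (1 - x) + b * x * (x - 1 / 2)) ^ 2 - x * j * b * (1 / 2 - x ^ 2) - x * (1 - x) * b ^ 2 * (1 / 4)
      = j ^ 2 * (1 - x) ^ 2 + j * b * (2 * (1 - x) * x * (x - 1 / 2) - x * (1 / 2 - x ^ 2))
        + b ^ 2 * (x ^ 2 * (x - 1 / 2) ^ 2 - x * (1 - x) * (1 / 4)) := by ring
  have hΦ : 0 ≤ (j * (1 - x) + b * x * (x - 1 / 2)) ^ 2 - x * j * b * (1 / 2 - x ^ 2) - x * (1 - x) * b ^ 2 * (1 / 4) := by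
    rw [key]
    have hφ' : 0 ≤ (1 - x) ^ 2 + (2 * (1 - x) * x * (x - 1 / 2) - x * (1 / 2 - x ^ 2))
        + (x ^ 2 * (x - 1 / 2) ^ 2 - x * (1 - x) * (1 / 4)) := by
      have e : (1 - x) ^ 2 + (2 * (1 - x) * x * (x - 1 / 2) - x * (1 / 2 - x ^ 2))
          + (x ^ 2 * (x - 1 / 2) ^ 2 - x * (1 - x) * (1 / 4))
          = ((1 - x) + x * (x - 1 / 2)) ^ 2 - x * (1 / 2 - x ^ 2) - x * (1 - x) * (1 / 4) := by ring
      rw [e]; exact hφ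
    nlinarith [mul_nonneg (mul_nonneg hb (sub_nonneg.2 hbj)) (neg_nonneg.2 hc2),
      mul_nonneg (mul_nonneg (sub_nonneg.2 hbj) hj) (sq_nonneg (1 - x)), mul_nonneg (mul_nonneg hb hj) hφ']
  linarith

/-- **The Cantelli cell, algebraic form.**  Reals `1/2 ≤ x < 1`, `x² ≤ g ≤ x`, `0 ≤ b ≤ j`, `A ≤ 2j`, `g·A < j` (not mergeable) and the
DIB\* credit `2j(1−x) < (1−x)B + b(g − x²)`; then `x·(j(A − B) + b²g(1−g)) ≤ (1−x)(B + bg − j)²` — i.e. Cantelli with the variance bound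
`V ≤ j(A−B) + b²g(1−g)` certifies `P(N ≤ j) ≤ 1 − x`. [this work] -/
theorem main (x g b j A B : ℝ) (hx : 1 / 2 ≤ x) (hx1 : x < 1) (hgx2 : x ^ 2 ≤ g) (hgx : g ≤ x)
    (hb : 0 ≤ b) (hbj : b ≤ j) (hA2 : A ≤ 2 * j) (hG : g * A < j)
    (hcredit : 2 * j * (1 - x) < (1 - x) * B + b * (g - x ^ 2)) :
    x * (j * (A - B) + b ^ 2 * g * (1 - g)) ≤ (1 - x) * (B + b * g - j) ^ 2 := by
  have hy : 0 < 1 - x := by linarith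
  have hj : 0 ≤ j := hb.trans hbj
  have hx0 : 0 < x := by linarith
  have hg0 : 0 < g := lt_of_lt_of_le (by nlinarith) hgx2
  -- `y s > t := j y + b x (x − g) ≥ 0`, from the credit
  set t : ℝ := j * (1 - x) + b * x * (x - g) with ht
  have hσ : 0 ≤ b * x * (x - g) := by
    have : 0 ≤ x - g := by linarith
    positivity
  have ht0 : 0 ≤ t := by rw [ht]; nlinarith
  have hs : t < (1 - x) * (B + b * g - j) := by rw [ht]; nlinarith
  have hst : t ^ 2 ≤ ((1 - x) * (B + b * g - j)) ^ 2 := pow_le_pow_left₀ ht0 hs.le 2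
  have hcr : 0 ≤ (1 - x) * B - 2 * j * (1 - x) + b * (g - x ^ 2) := by linarith
  by_cases hg2 : 1 / 2 ≤ g
  · have hP := Pnonneg x g b j hx hx1 hgx2 hg2 hgx hb hbj
    -- (⋆) := g (y s)² − x y j (j − g B) − x y b² g² (1−g) = P + g((ys)² − t²) + x j g (yB − 2yj + b(g−x²)) ≥ 0
    have hstar : 0 ≤ g * ((1 - x) * (B + b * g - j)) ^ 2 - x * (1 - x) * j * (j - g * B)
        - x * (1 - x) * b ^ 2 * g ^ 2 * (1 - g) := by
      have e : g * ((1 - x) * (B + b * g - j)) ^ 2 - x * (1 - x) * j * (j - g * B) - x * (1 - x) * b ^ 2 * g ^ 2 * (1 - g)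
          = (g * (j * (1 - x) + b * x * (x - g)) ^ 2 - x * (1 - x) * j ^ 2 * (1 - 2 * g) - x * j * b * g * (g - x ^ 2)
              - x * (1 - x) * b ^ 2 * g ^ 2 * (1 - g))
            + g * (((1 - x) * (B + b * g - j)) ^ 2 - (j * (1 - x) + b * x * (x - g)) ^ 2)
            + x * j * g * ((1 - x) * B - 2 * j * (1 - x) + b * (g - x ^ 2)) := by ring
      rw [e]
      have h2 : 0 ≤ g * (((1 - x) * (B + b * g - j)) ^ 2 - (j * (1 - x) + b * x * (x - g)) ^ 2) :=
        mul_nonneg hg0.le (by rw [ht] at hst; linarith)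
      have h3 : 0 ≤ x * j * g * ((1 - x) * B - 2 * j * (1 - x) + b * (g - x ^ 2)) :=
        mul_nonneg (by positivity) hcr
      linarith
    -- g x j (A − B) ≤ x j (j − g B)
    have hAB : g * (x * j * (A - B)) ≤ x * j * (j - g * B) := by
      have : x * j * (g * A) ≤ x * j * j := mul_le_mul_of_nonneg_left hG.le (by positivity)
      nlinarith
    -- conclude: g y [y s² − x j (A−B) − x b² g (1−g)] ≥ (⋆) ≥ 0
    have hfin : 0 ≤ g * (1 - x) * ((1 - x) * (B + b * g - j) ^ 2 - x * (j * (A - B) + b ^ 2 * g * (1 - g))) := by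
      have e : g * (1 - x) * ((1 - x) * (B + b * g - j) ^ 2 - x * (j * (A - B) + b ^ 2 * g * (1 - g)))
          = g * ((1 - x) * (B + b * g - j)) ^ 2 - (1 - x) * (g * (x * j * (A - B)))
            - x * (1 - x) * b ^ 2 * g ^ 2 * (1 - g) := by ring
      rw [e]
      nlinarith [mul_le_mul_of_nonneg_left hAB hy.le]
    have hgy : 0 < g * (1 - x) := mul_pos hg0 hy
    have := nonneg_of_mul_nonneg_right (by linarith [hfin] : 0 ≤ (g * (1 - x)) *
      ((1 - x) * (B + b * g - j) ^ 2 - x * (j * (A - B) + b ^ 2 * g * (1 - g)))) hgy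
    linarith
  · push Not at hg2
    have hP := P2nonneg x g b j hx hx1 hgx2 hg2.le hb hbj
    -- (⋆⋆) := (y s)² − x y j (2j − B) − x y b² g (1−g) = P'' + ((ys)² − t²) + x j (yB − 2yj + b(g − x²)) ≥ 0
    have hstar : 0 ≤ ((1 - x) * (B + b * g - j)) ^ 2 - x * (1 - x) * j * (2 * j - B)
        - x * (1 - x) * b ^ 2 * g * (1 - g) := by
      have e : ((1 - x) * (B + b * g - j)) ^ 2 - x * (1 - x) * j * (2 * j - B) - x * (1 - x) * b ^ 2 * g * (1 - g)
          = ((j * (1 - x) + b * x * (x - g)) ^ 2 - x * j * b * (g - x ^ 2) - x * (1 - x) * b ^ 2 * g * (1 - g))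
            + (((1 - x) * (B + b * g - j)) ^ 2 - (j * (1 - x) + b * x * (x - g)) ^ 2)
            + x * j * ((1 - x) * B - 2 * j * (1 - x) + b * (g - x ^ 2)) := by ring
      rw [e]
      have h2 : 0 ≤ ((1 - x) * (B + b * g - j)) ^ 2 - (j * (1 - x) + b * x * (x - g)) ^ 2 := by
        rw [ht] at hst; linarith
      have h3 : 0 ≤ x * j * ((1 - x) * B - 2 * j * (1 - x) + b * (g - x ^ 2)) := mul_nonneg (by positivity) hcr
      linarith
    have hAB : x * j * (A - B) ≤ x * j * (2 * j - B) := mul_le_mul_of_nonneg_left (by linarith) (by positivity)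
    have hfin : 0 ≤ (1 - x) * ((1 - x) * (B + b * g - j) ^ 2 - x * (j * (A - B) + b ^ 2 * g * (1 - g))) := by
      have e : (1 - x) * ((1 - x) * (B + b * g - j) ^ 2 - x * (j * (A - B) + b ^ 2 * g * (1 - g)))
          = ((1 - x) * (B + b * g - j)) ^ 2 - (1 - x) * (x * j * (A - B)) - x * (1 - x) * b ^ 2 * g * (1 - g) := by ring
      rw [e]
      nlinarith [mul_le_mul_of_nonneg_left hAB hy.le]
    have := nonneg_of_mul_nonneg_right (by linarith [hfin] : 0 ≤ (1 - x) *
      ((1 - x) * (B + b * g - j) ^ 2 - x * (j * (A - B) + b ^ 2 * g * (1 - g)))) hy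
    linarith


end OneLightAlg

end IndepBlob

end Quant

end Summit.CriticalPhenomena.PercolationContinuityZ3.Theorems
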